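import Summits.Ventures.HSemireg.WedgeHankelRecurrenceGaussChebyshevGarnierRamare

/-!
# Venture HSemireg — **MONOTONICITY ON THE LEFT HALF-LINE: for even `n ≠ 0` the polynomials `T_n`, `U_n` are strictly DEcreasing on `(−∞, −1]` and `C_n`, `S_n` on `(−∞, −2]`; for odd `n` they are
# strictly INcreasing there** (parity `T_n(−x) = (−1)^n T_n(x)`, `U_n(−x) = (−1)^n U_n(x)` applied to the right-half-line statements of N522)

HONEST FRAMING. Part of the Lean index of the computation cell `pub-hsemireg` (seat p10 gen 49, Sunday typer «UNIFORM-IN-n»).  Real polynomial inequalities only (Mathlib `Polynomial.Chebyshev.T ∕ U ∕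
C ∕ S` over `ℝ`); no variety, no cohomology theory, no sheaf, no Ext group and no semiregularity map is constructed here; nothing here says that HC / HC_CM / HC_AV holds; no Literature fact
(unproved `Prop`) is declared or used.  Custodian versions as in `WedgeHankelSiegelIdeal` (1/3).
SOURCES (cited).  T. J. Rivlin, *The Chebyshev Polynomials* (Wiley 1974), §1.2, §2.7; J. C. Mason, D. C. Handscomb, *Chebyshev Polynomials* (2003), §1.4 (symmetry `T_n(−x) = (−1)^n T_n(x)` and
growth outside `[−1, 1]`).
PROOF TYPED HERE.  For `x < y ≤ −1`: `1 ≤ −y < −x`, so N522 `chebyshevT_real_strictMonoOn` gives `T_n(−y) < T_n(−x)`; Mathlib `T_eval_neg` and `Int.negOnePow_even ∕ _odd` turn this into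
`T_n(y) < T_n(x)` (even) resp. `T_n(x) < T_n(y)` (odd); the same with `U_eval_neg` (`n ∈ ℕ`, `(−1)^n`), and the `x∕2` transports `S_n(x) = U_n(x∕2)`, `C_n(x) = 2T_n(x∕2)` (N521) for `(−∞, −2]`.
DEDUP DISCLOSURE (`rg -n 'StrictAntiOn|Iic \\(-' Summits/Ventures/HSemireg -g 'WedgeHankelRecurrenceGaussChebyshev*'`, 2026-09-04): N522 has the right half-lines only (its CAVEATS line announces this
file); Mathlib ∕ Literature have no left-half-line monotonicity of `T ∕ U ∕ C ∕ S`; 0 hits for the 8 names below.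

WHAT IS IN THE TREE.  N522 `chebyshevT_real_strictMonoOn`, `chebyshevU_real_strictMonoOn`; N521 `chebyshevS_eval_eq_U_eval_half`, `chebyshevC_eval_eq_two_mul_T_eval_half`; Mathlib `T_eval_neg`, `U_eval_neg`,
`Int.negOnePow_even`, `Int.negOnePow_odd`, `Int.cast_negOnePow_natCast`, `Even.neg_one_pow`, `Odd.neg_one_pow`.
THIS FILE (namespace `Summit.Ventures.HSemireg.Wedge.HankelOuter` continued; CHAINED on N530; 0 definitions):
* §1296 **`chebyshevT_real_strictAntiOn_of_even`**, **`chebyshevT_real_strictMonoOn_of_odd`** (`n ∈ ℤ`, on `(−∞, −1]`), **`chebyshevU_real_strictAntiOn_of_even`**,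
  **`chebyshevU_real_strictMonoOn_of_odd`** (`n ∈ ℕ`, on `(−∞, −1]`), **`chebyshevC_real_strictAntiOn_of_even`**, **`chebyshevC_real_strictMonoOn_of_odd`** (`n ∈ ℤ`, on `(−∞, −2]`),
  **`chebyshevS_real_strictAntiOn_of_even`**, **`chebyshevS_real_strictMonoOn_of_odd`** (`n ∈ ℕ`, on `(−∞, −2]`).
CAVEATS.  Even case needs `n ≠ 0` (`T_0 = C_0∕2 = U_0 = S_0 = 1` are constant).  Nothing Ext-side.  New names only.
-/

open Module Polynomial
open scoped Matrix Polynomial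

namespace Summit.Ventures.HSemireg.Wedge.HankelOuter

/-! ## §1296. Monotonicity of `T_n`, `U_n`, `C_n`, `S_n` on the left half-line -/

/-- **For even `n ≠ 0`, `T_n` is strictly decreasing on `(−∞, −1]`.** [Rivlin 1974, §1.2; this file, §1296] -/
theorem chebyshevT_real_strictAntiOn_of_even {n : ℤ} (hn : n ≠ 0) (he : Even n) : StrictAntiOn (fun x : ℝ => (Polynomial.Chebyshev.T ℝ n).eval x) (Set.Iic (-1)) := by
  intro x hx y hy hxy
  simp only [Set.mem_Iic] at hx hy
  have h := chebyshevT_real_strictMonoOn hn (Set.mem_Ici.mpr (by linarith : (1 : ℝ) ≤ -y)) (Set.mem_Ici.mpr (by linarith : (1 : ℝ) ≤ -x)) (by linarith : -y < -x)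
  simp only [Polynomial.Chebyshev.T_eval_neg, Int.negOnePow_even n he, Units.val_one, Int.cast_one, one_mul] at h
  exact h

/-- **For odd `n`, `T_n` is strictly increasing on `(−∞, −1]`.** [Rivlin 1974, §1.2; this file, §1296] -/
theorem chebyshevT_real_strictMonoOn_of_odd {n : ℤ} (ho : Odd n) : StrictMonoOn (fun x : ℝ => (Polynomial.Chebyshev.T ℝ n).eval x) (Set.Iic (-1)) := by
  have hn : n ≠ 0 := by rintro rfl; exact Int.not_odd_iff_even.mpr (by decide) ho
  intro x hx y hy hxy
  simp only [Set.mem_Iic] at hx hy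
  have h := chebyshevT_real_strictMonoOn hn (Set.mem_Ici.mpr (by linarith : (1 : ℝ) ≤ -y)) (Set.mem_Ici.mpr (by linarith : (1 : ℝ) ≤ -x)) (by linarith : -y < -x)
  simp only [Polynomial.Chebyshev.T_eval_neg, Int.negOnePow_odd n ho, Units.val_neg, Units.val_one, Int.cast_neg, Int.cast_one, neg_mul, one_mul, neg_lt_neg_iff] at h
  exact h

/-- **For even `n ≠ 0`, `U_n` is strictly decreasing on `(−∞, −1]`.** [Rivlin 1974, §1.2; this file, §1296] -/
theorem chebyshevU_real_strictAntiOn_of_even {n : ℕ} (hn : n ≠ 0) (he : Even n) : StrictAntiOn (fun x : ℝ => (Polynomial.Chebyshev.U ℝ (n : ℤ)).eval x) (Set.Iic (-1)) := by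
  intro x hx y hy hxy
  simp only [Set.mem_Iic] at hx hy
  have h := chebyshevU_real_strictMonoOn hn (Set.mem_Ici.mpr (by linarith : (1 : ℝ) ≤ -y)) (Set.mem_Ici.mpr (by linarith : (1 : ℝ) ≤ -x)) (by linarith : -y < -x)
  simp only [Polynomial.Chebyshev.U_eval_neg, Int.cast_negOnePow_natCast, he.neg_one_pow, one_mul] at h
  exact h

/-- **For odd `n`, `U_n` is strictly increasing on `(−∞, −1]`.** [Rivlin 1974, §1.2; this file, §1296] -/
theorem chebyshevU_real_strictMonoOn_of_odd {n : ℕ} (ho : Odd n) : StrictMonoOn (fun x : ℝ => (Polynomial.Chebyshev.U ℝ (n : ℤ)).eval x) (Set.Iic (-1)) := by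
  have hn : n ≠ 0 := by rintro rfl; exact Nat.not_odd_iff_even.mpr (by decide) ho
  intro x hx y hy hxy
  simp only [Set.mem_Iic] at hx hy
  have h := chebyshevU_real_strictMonoOn hn (Set.mem_Ici.mpr (by linarith : (1 : ℝ) ≤ -y)) (Set.mem_Ici.mpr (by linarith : (1 : ℝ) ≤ -x)) (by linarith : -y < -x)
  simp only [Polynomial.Chebyshev.U_eval_neg, Int.cast_negOnePow_natCast, ho.neg_one_pow, neg_mul, one_mul, neg_lt_neg_iff] at h
  exact h

/-- **For even `n ≠ 0`, `C_n` is strictly decreasing on `(−∞, −2]`** (`C_n(x) = 2T_n(x∕2)`). [Rivlin 1974, §1.2; this file, §1296] -/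
theorem chebyshevC_real_strictAntiOn_of_even {n : ℤ} (hn : n ≠ 0) (he : Even n) : StrictAntiOn (fun x : ℝ => (Polynomial.Chebyshev.C ℝ n).eval x) (Set.Iic (-2)) := by
  intro x hx y hy hxy
  simp only [Set.mem_Iic] at hx hy
  show (Polynomial.Chebyshev.C ℝ n).eval y < (Polynomial.Chebyshev.C ℝ n).eval x
  rw [chebyshevC_eval_eq_two_mul_T_eval_half, chebyshevC_eval_eq_two_mul_T_eval_half]
  have h := chebyshevT_real_strictAntiOn_of_even hn he (Set.mem_Iic.mpr (by linarith : x / 2 ≤ -1)) (Set.mem_Iic.mpr (by linarith : y / 2 ≤ -1)) (by linarith : x / 2 < y / 2)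
  simp only at h
  linarith

/-- **For odd `n`, `C_n` is strictly increasing on `(−∞, −2]`.** [Rivlin 1974, §1.2; this file, §1296] -/
theorem chebyshevC_real_strictMonoOn_of_odd {n : ℤ} (ho : Odd n) : StrictMonoOn (fun x : ℝ => (Polynomial.Chebyshev.C ℝ n).eval x) (Set.Iic (-2)) := by
  intro x hx y hy hxy
  simp only [Set.mem_Iic] at hx hy
  show (Polynomial.Chebyshev.C ℝ n).eval x < (Polynomial.Chebyshev.C ℝ n).eval y
  rw [chebyshevC_eval_eq_two_mul_T_eval_half, chebyshevC_eval_eq_two_mul_T_eval_half]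
  have h := chebyshevT_real_strictMonoOn_of_odd ho (Set.mem_Iic.mpr (by linarith : x / 2 ≤ -1)) (Set.mem_Iic.mpr (by linarith : y / 2 ≤ -1)) (by linarith : x / 2 < y / 2)
  simp only at h
  linarith

/-- **For even `n ≠ 0`, `S_n` is strictly decreasing on `(−∞, −2]`** (`S_n(x) = U_n(x∕2)`). [Rivlin 1974, §1.2; this file, §1296] -/
theorem chebyshevS_real_strictAntiOn_of_even {n : ℕ} (hn : n ≠ 0) (he : Even n) : StrictAntiOn (fun x : ℝ => (Polynomial.Chebyshev.S ℝ (n : ℤ)).eval x) (Set.Iic (-2)) := by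
  intro x hx y hy hxy
  simp only [Set.mem_Iic] at hx hy
  show (Polynomial.Chebyshev.S ℝ (n : ℤ)).eval y < (Polynomial.Chebyshev.S ℝ (n : ℤ)).eval x
  rw [chebyshevS_eval_eq_U_eval_half, chebyshevS_eval_eq_U_eval_half]
  exact chebyshevU_real_strictAntiOn_of_even hn he (Set.mem_Iic.mpr (by linarith : x / 2 ≤ -1)) (Set.mem_Iic.mpr (by linarith : y / 2 ≤ -1)) (by linarith : x / 2 < y / 2)

/-- **For odd `n`, `S_n` is strictly increasing on `(−∞, −2]`.** [Rivlin 1974, §1.2; this file, §1296] -/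
theorem chebyshevS_real_strictMonoOn_of_odd {n : ℕ} (ho : Odd n) : StrictMonoOn (fun x : ℝ => (Polynomial.Chebyshev.S ℝ (n : ℤ)).eval x) (Set.Iic (-2)) := by
  intro x hx y hy hxy
  simp only [Set.mem_Iic] at hx hy
  show (Polynomial.Chebyshev.S ℝ (n : ℤ)).eval x < (Polynomial.Chebyshev.S ℝ (n : ℤ)).eval y
  rw [chebyshevS_eval_eq_U_eval_half, chebyshevS_eval_eq_U_eval_half]
  exact chebyshevU_real_strictMonoOn_of_odd ho (Set.mem_Iic.mpr (by linarith : x / 2 ≤ -1)) (Set.mem_Iic.mpr (by linarith : y / 2 ≤ -1)) (by linarith : x / 2 < y / 2)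

end Summit.Ventures.HSemireg.Wedge.HankelOuter
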